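import Literature.AnabelianGeometry.SemiGraphs.PSCTwoComponentUnmarkedNodeTerminal
import Literature.AnabelianGeometry.SemiGraphs.PSCSeparatingCoveringsTwoComponentUnmarked
import Literature.AnabelianGeometry.SemiGraphs.PSCSeparatingCoveringsTwoComponentUnmarkedEdges
import Literature.AnabelianGeometry.SemiGraphs.PSCTwoComponentUnmarkedOrigin
import HarnessLib

/-!
# [CombGC] Prop. 1.2 IN FULL and the separating coverings at two-component data with `C₁` UNMARKED

Mochizuki, *A combinatorial version of the Grothendieck conjecture*, Tohoku Math. J. **59** (2007)
[CombGC], Prop. 1.2 p. 8 and its proof p. 9 [cite: MochizukiCombGC2007, Prop 1.2 pp.8-9].  abc-iut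
FACT-LIST rows F-0438 `CommensurableTerminalityHolds`, F-0459 `OpenInterDeterminesComponentHolds`, F-2829
`SeparatingCoverings`, F-2830 `SeparatingCoveringsHolds` (schemata over `Ω : PSCOrigin`; universal closures
refuted; instance forms at genuine carriers are the content).

PROOF-ONLY CAPSTONE (abc-iut-f-166 gen 5) for the data of two-component shape with the second component
UNMARKED (abc-iut-f-164 gen 2, `PSCTwoComponentUnmarkedOrigin.lean`) — the first two-component shape at
which NEITHER `Π_{v₀} = cl ι⟨a_i, b_i (i<g₀), c_j⟩` NOR the node group `Π_ν = cl ι⟨(∏_{i≥g₀}[a_i,b_i])⁻¹⟩`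
is the closure of a free factor of `Γ_{g,r}`.  Conjunction of four deliveries BY NAME:
abc-iut-f-164 gen 5's `verticialRows_of_twoComponentUnmarked` (F-2826 + verticial commensurable
terminality, cut-off character twist), this seat's `edgeLike_commensurator_eq_of_twoComponentUnmarked`
(node malnormal as the boundary cusp of the free factor `cl ι⟨a_i, b_i : i ≥ g₀⟩`, `PSCTwoComponentUnmarkedNodeTerminal.lean`)
and `edgeLikeSeparatingCoverings_of_twoComponentUnmarked` (F-2827 through a LEVEL free factor,
`PSCSeparatingCoveringsTwoComponentUnmarkedEdges.lean`, `r ≥ 2`), abc-iut-f-164 gen 4's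
`unrRows_of_twoComponent` (F-2828 + sturdy `Π^unr`-clauses) and gen 2's
`openInterDeterminesComponent_of_twoComponentUnmarked` (Prop. 1.2 (i)).

* `verticialEdgeLikeCommensurablyTerminal_of_twoComponentUnmarked`, `commensurablyTerminal_of_twoComponentUnmarked`
  — Prop. 1.2 (ii), first clause resp. BOTH clauses, at EVERY unmarked-`C₁` datum (`r ≥ 1`);
* `prop12_of_twoComponentUnmarked` — ALL FIVE typed clauses of Prop. 1.2 (i)(ii) there;
* `separatingCoverings_of_twoComponentUnmarked` — F-2829, all three conjuncts, for `r ≥ 2`;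
* `twoComponentUnmarkedOrigin_commensurableTerminalityHolds` — **F-0438 (both clauses) at every origin of
  unmarked-`C₁` data** (gen 2's origin hypothesis BY NAME) and the conjunction
  `twoComponentUnmarkedOrigin_prop12_holds` (F-0459 ∧ F-0438);
  `twoComponentUnmarkedOrigin_separatingCoveringsHolds` — F-2830 at every such origin with `r ≥ 2`;
  `twoComponentUnmarkedOrigin_prop12_rows` — abc-iut-f-164 gen 5's origin row F-2829 ∧ (i) ∧ (ii) (p501083,
  filed to the same basename while this file was pending; restored here).

Instance forms at data of the shape of genuine two-component curves: consistency evidence for the typed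
schemata, not the printed theorem for all pointed stable curves (cell FOUNDATIONS rows 13–14).
0 definitions; nothing here takes a side on [IUTchIII] Cor. 3.12.
-/

noncomputable section

namespace Literature.AnabelianGeometry.SemiGraphs

namespace PSCDatum

open scoped Pointwise
open Literature.GroupTheory.CombinatorialGroupTheory
open Literature.GroupTheory.CombinatorialGroupTheory.PuncturedSurfaceGroup (cuspInertia)
open SemiGraphOfAnabelioids (IsProSigmaCompletion)

section Datum

variable {P : Type} [Group P] [TopologicalSpace P] [IsTopologicalGroup P]
variable [CompactSpace P] [T2Space P] [TotallyDisconnectedSpace P] {Sigma : Set ℕ} {g r : ℕ}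

/-- **[CombGC] Prop. 1.2 (ii), FIRST clause, at every two-component datum with `C₁` unmarked** (`s = 0`,
`r ≥ 1`, `2g₀ + r ≥ 2`, `g − g₀ ≥ 1`): verticial subgroups by abc-iut-f-164 gen 5's cut-off twist
(`verticialRows_of_twoComponentUnmarked`), edge-like subgroups by `edgeLike_commensurator_eq_of_twoComponentUnmarked`.
[cite: MochizukiCombGC2007, Prop 1.2(ii) p.8] -/
theorem verticialEdgeLikeCommensurablyTerminal_of_twoComponentUnmarked (hne : Sigma.Nonempty)
    (hprime : ∀ p ∈ Sigma, p.Prime) (ι : PuncturedSurfaceGroup g r →* P)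
    (hι : IsProSigmaCompletion Sigma ι) (G : PSCDatum P) {g₀ s : ℕ} (hg₀ : g₀ ≤ g) (hs : s = 0)
    (hr : 1 ≤ r) (hst₀ : 1 ≤ g₀ ∨ 2 ≤ r) (hg₁ : 1 ≤ g - g₀) (e : G.graph.C ≃ Fin r)
    (hC : ∀ c', G.cuspGp c' = ((cuspInertia (g := g) (e c')).map ι).topologicalClosure)
    (v₀ v₁ : G.graph.V) (hV : ∀ w, w = v₀ ∨ w = v₁) (ε : PuncturedSurfaceGroup g r)
    (hε : ε = ((List.finRange r).map fun j : Fin r =>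
          if s ≤ (j : ℕ) then PuncturedSurfaceGroup.c (g := g) j else 1).prod *
        ((List.finRange g).map fun i : Fin g => if (i : ℕ) < g₀ then
          PuncturedSurfaceGroup.a (r := r) i * PuncturedSurfaceGroup.b i *
            (PuncturedSurfaceGroup.a i)⁻¹ * (PuncturedSurfaceGroup.b i)⁻¹ else 1).prod)
    (hV₀ : G.vertGp v₀ = ((Subgroup.closure {x : PuncturedSurfaceGroup g r |
        (∃ i : Fin g, (i : ℕ) < g₀ ∧ (x = PuncturedSurfaceGroup.a i ∨ x = PuncturedSurfaceGroup.b i)) ∨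
        ∃ j : Fin r, s ≤ (j : ℕ) ∧ x = PuncturedSurfaceGroup.c j}).map ι).topologicalClosure)
    (hV₁ : G.vertGp v₁ = ((Subgroup.closure {x : PuncturedSurfaceGroup g r |
        (∃ i : Fin g, g₀ ≤ (i : ℕ) ∧ (x = PuncturedSurfaceGroup.a i ∨ x = PuncturedSurfaceGroup.b i)) ∨
        (∃ j : Fin r, (j : ℕ) < s ∧ x = PuncturedSurfaceGroup.c j) ∨ x = ε}).map ι).topologicalClosure)
    (n₀ : G.graph.N) (hN : ∀ n, n = n₀)
    (hE : G.nodeGp n₀ = ((Subgroup.zpowers ε).map ι).topologicalClosure) :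
    G.VerticialEdgeLikeCommensurablyTerminal := by
  intro A hA
  rcases hA with hv | he
  · exact (G.verticialRows_of_twoComponentUnmarked hne hprime ι hι hs hr hst₀ hg₁ v₀ v₁ hV ε hε hV₀ hV₁).2.2
      A hv
  · exact G.edgeLike_commensurator_eq_of_twoComponentUnmarked hne hprime ι hι hg₀ hs hr hg₁ e hC ε hε n₀ hN hE
      A he

/-- **[CombGC] Prop. 1.2 (ii), BOTH clauses, at every two-component datum with `C₁` unmarked** (the sturdy
`Π^unr`-clause is abc-iut-f-164 gen 4's `unrRows_of_twoComponent`). [cite: MochizukiCombGC2007, Prop 1.2(ii) p.8] -/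
theorem commensurablyTerminal_of_twoComponentUnmarked (hne : Sigma.Nonempty)
    (hprime : ∀ p ∈ Sigma, p.Prime) (ι : PuncturedSurfaceGroup g r →* P)
    (hι : IsProSigmaCompletion Sigma ι) (G : PSCDatum P) {g₀ s : ℕ} (hg₀ : g₀ ≤ g) (hs : s = 0)
    (hr : 1 ≤ r) (hst₀ : 1 ≤ g₀ ∨ 2 ≤ r) (hg₁ : 1 ≤ g - g₀) (e : G.graph.C ≃ Fin r)
    (hC : ∀ c', G.cuspGp c' = ((cuspInertia (g := g) (e c')).map ι).topologicalClosure)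
    (v₀ v₁ : G.graph.V) (hV : ∀ w, w = v₀ ∨ w = v₁) (ε : PuncturedSurfaceGroup g r)
    (hε : ε = ((List.finRange r).map fun j : Fin r =>
          if s ≤ (j : ℕ) then PuncturedSurfaceGroup.c (g := g) j else 1).prod *
        ((List.finRange g).map fun i : Fin g => if (i : ℕ) < g₀ then
          PuncturedSurfaceGroup.a (r := r) i * PuncturedSurfaceGroup.b i *
            (PuncturedSurfaceGroup.a i)⁻¹ * (PuncturedSurfaceGroup.b i)⁻¹ else 1).prod)
    (hV₀ : G.vertGp v₀ = ((Subgroup.closure {x : PuncturedSurfaceGroup g r |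
        (∃ i : Fin g, (i : ℕ) < g₀ ∧ (x = PuncturedSurfaceGroup.a i ∨ x = PuncturedSurfaceGroup.b i)) ∨
        ∃ j : Fin r, s ≤ (j : ℕ) ∧ x = PuncturedSurfaceGroup.c j}).map ι).topologicalClosure)
    (hV₁ : G.vertGp v₁ = ((Subgroup.closure {x : PuncturedSurfaceGroup g r |
        (∃ i : Fin g, g₀ ≤ (i : ℕ) ∧ (x = PuncturedSurfaceGroup.a i ∨ x = PuncturedSurfaceGroup.b i)) ∨
        (∃ j : Fin r, (j : ℕ) < s ∧ x = PuncturedSurfaceGroup.c j) ∨ x = ε}).map ι).topologicalClosure)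
    (n₀ : G.graph.N) (hN : ∀ n, n = n₀)
    (hE : G.nodeGp n₀ = ((Subgroup.zpowers ε).map ι).topologicalClosure)
    (hgen₀ : G.genus v₀ = g₀) (hgen₁ : G.genus v₁ = g - g₀) :
    G.VerticialEdgeLikeCommensurablyTerminal ∧ G.UnrVerticialCommensurablyTerminal :=
  ⟨G.verticialEdgeLikeCommensurablyTerminal_of_twoComponentUnmarked hne hprime ι hι hg₀ hs hr hst₀ hg₁ e hC
      v₀ v₁ hV ε hε hV₀ hV₁ n₀ hN hE,
    (G.unrRows_of_twoComponent hne hprime ι hι e hC n₀ hN v₀ v₁ hV ε hε hV₀ hV₁ hE hgen₀ hgen₁).2.2⟩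

/-- **[CombGC] Prop. 1.2 — ALL FIVE typed clauses of (i) and (ii) — at every two-component datum with `C₁`
unmarked**: `VerticialOpenInterDeterminesVertex ∧ EdgeLikeOpenInterDeterminesEdge ∧
UnrVerticialOpenInterDeterminesVertex` (abc-iut-f-164 gen 2) `∧ VerticialEdgeLikeCommensurablyTerminal ∧
UnrVerticialCommensurablyTerminal`. [cite: MochizukiCombGC2007, Prop 1.2 pp.8-9] -/
theorem prop12_of_twoComponentUnmarked (hne : Sigma.Nonempty)
    (hprime : ∀ p ∈ Sigma, p.Prime) (ι : PuncturedSurfaceGroup g r →* P)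
    (hι : IsProSigmaCompletion Sigma ι) (G : PSCDatum P) {g₀ s : ℕ} (hg₀ : g₀ ≤ g) (hs : s = 0)
    (hr : 1 ≤ r) (hst₀ : 1 ≤ g₀ ∨ 2 ≤ r) (hg₁ : 1 ≤ g - g₀) (e : G.graph.C ≃ Fin r)
    (hC : ∀ c', G.cuspGp c' = ((cuspInertia (g := g) (e c')).map ι).topologicalClosure)
    (v₀ v₁ : G.graph.V) (hV : ∀ w, w = v₀ ∨ w = v₁) (ε : PuncturedSurfaceGroup g r)
    (hε : ε = ((List.finRange r).map fun j : Fin r =>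
          if s ≤ (j : ℕ) then PuncturedSurfaceGroup.c (g := g) j else 1).prod *
        ((List.finRange g).map fun i : Fin g => if (i : ℕ) < g₀ then
          PuncturedSurfaceGroup.a (r := r) i * PuncturedSurfaceGroup.b i *
            (PuncturedSurfaceGroup.a i)⁻¹ * (PuncturedSurfaceGroup.b i)⁻¹ else 1).prod)
    (hV₀ : G.vertGp v₀ = ((Subgroup.closure {x : PuncturedSurfaceGroup g r |
        (∃ i : Fin g, (i : ℕ) < g₀ ∧ (x = PuncturedSurfaceGroup.a i ∨ x = PuncturedSurfaceGroup.b i)) ∨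
        ∃ j : Fin r, s ≤ (j : ℕ) ∧ x = PuncturedSurfaceGroup.c j}).map ι).topologicalClosure)
    (hV₁ : G.vertGp v₁ = ((Subgroup.closure {x : PuncturedSurfaceGroup g r |
        (∃ i : Fin g, g₀ ≤ (i : ℕ) ∧ (x = PuncturedSurfaceGroup.a i ∨ x = PuncturedSurfaceGroup.b i)) ∨
        (∃ j : Fin r, (j : ℕ) < s ∧ x = PuncturedSurfaceGroup.c j) ∨ x = ε}).map ι).topologicalClosure)
    (n₀ : G.graph.N) (hN : ∀ n, n = n₀)
    (hE : G.nodeGp n₀ = ((Subgroup.zpowers ε).map ι).topologicalClosure)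
    (hgen₀ : G.genus v₀ = g₀) (hgen₁ : G.genus v₁ = g - g₀) :
    (G.VerticialOpenInterDeterminesVertex ∧ G.EdgeLikeOpenInterDeterminesEdge ∧
      G.UnrVerticialOpenInterDeterminesVertex) ∧
      G.VerticialEdgeLikeCommensurablyTerminal ∧ G.UnrVerticialCommensurablyTerminal :=
  ⟨G.openInterDeterminesComponent_of_twoComponentUnmarked hne hprime ι hι hg₀ hs hr hst₀ hg₁ e hC v₀ v₁ hV ε
      hε hV₀ hV₁ n₀ hN hE hgen₀ hgen₁,
    G.commensurablyTerminal_of_twoComponentUnmarked hne hprime ι hι hg₀ hs hr hst₀ hg₁ e hC v₀ v₁ hV ε hε hV₀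
      hV₁ n₀ hN hE hgen₀ hgen₁⟩

omit [T2Space P] in
/-- **F-2829 `SeparatingCoverings` — all three conjuncts — at every two-component datum with `C₁` unmarked
and `r ≥ 2`**: ⟨F-2826 abc-iut-f-164 gen 5, F-2827 this seat (level free factor), F-2828 abc-iut-f-164 gen 4⟩.
[cite: MochizukiCombGC2007, Prop 1.2 proof p.9] -/
theorem separatingCoverings_of_twoComponentUnmarked (hne : Sigma.Nonempty)
    (hprime : ∀ p ∈ Sigma, p.Prime) (ι : PuncturedSurfaceGroup g r →* P)
    (hι : IsProSigmaCompletion Sigma ι) (G : PSCDatum P) {g₀ s : ℕ} (hg₀ : g₀ ≤ g) (hs : s = 0)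
    (hr : 2 ≤ r) (hg₁ : 1 ≤ g - g₀) (e : G.graph.C ≃ Fin r)
    (hC : ∀ c', G.cuspGp c' = ((cuspInertia (g := g) (e c')).map ι).topologicalClosure)
    (v₀ v₁ : G.graph.V) (hV : ∀ w, w = v₀ ∨ w = v₁) (ε : PuncturedSurfaceGroup g r)
    (hε : ε = ((List.finRange r).map fun j : Fin r =>
          if s ≤ (j : ℕ) then PuncturedSurfaceGroup.c (g := g) j else 1).prod *
        ((List.finRange g).map fun i : Fin g => if (i : ℕ) < g₀ then
          PuncturedSurfaceGroup.a (r := r) i * PuncturedSurfaceGroup.b i *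
            (PuncturedSurfaceGroup.a i)⁻¹ * (PuncturedSurfaceGroup.b i)⁻¹ else 1).prod)
    (hV₀ : G.vertGp v₀ = ((Subgroup.closure {x : PuncturedSurfaceGroup g r |
        (∃ i : Fin g, (i : ℕ) < g₀ ∧ (x = PuncturedSurfaceGroup.a i ∨ x = PuncturedSurfaceGroup.b i)) ∨
        ∃ j : Fin r, s ≤ (j : ℕ) ∧ x = PuncturedSurfaceGroup.c j}).map ι).topologicalClosure)
    (hV₁ : G.vertGp v₁ = ((Subgroup.closure {x : PuncturedSurfaceGroup g r |
        (∃ i : Fin g, g₀ ≤ (i : ℕ) ∧ (x = PuncturedSurfaceGroup.a i ∨ x = PuncturedSurfaceGroup.b i)) ∨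
        (∃ j : Fin r, (j : ℕ) < s ∧ x = PuncturedSurfaceGroup.c j) ∨ x = ε}).map ι).topologicalClosure)
    (n₀ : G.graph.N) (hN : ∀ n, n = n₀)
    (hE : G.nodeGp n₀ = ((Subgroup.zpowers ε).map ι).topologicalClosure)
    (hgen₀ : G.genus v₀ = g₀) (hgen₁ : G.genus v₁ = g - g₀) : G.SeparatingCoverings :=
  ⟨G.verticialSeparatingCoverings_of_twoComponentUnmarked hne hprime ι hι hs (by omega) (Or.inr hr) hg₁ v₀ v₁
      hV ε hε hV₀ hV₁,
    G.edgeLikeSeparatingCoverings_of_twoComponentUnmarked hne hprime ι hι hg₀ hs hr hg₁ e hC ε hε n₀ hN hE,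
    (G.unrRows_of_twoComponent hne hprime ι hι e hC n₀ hN v₀ v₁ hV ε hε hV₀ hV₁ hE hgen₀ hgen₁).1⟩

end Datum

/-! ### Origin level -/

section Origin

variable (Ω : PSCOrigin.{0})

/-- **F-0438 `CommensurableTerminalityHolds Ω` (BOTH clauses) at EVERY origin whose data are of two-component
shape with `C₁` unmarked** (abc-iut-f-164 gen 2's origin hypothesis of `PSCTwoComponentUnmarkedOrigin.lean`
BY NAME; `r ≥ 1`). [cite: MochizukiCombGC2007, Prop 1.2(ii) p.8] -/
theorem twoComponentUnmarkedOrigin_commensurableTerminalityHolds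
    (hΩ : ∀ ⦃Q : Type⦄ [Group Q] [TopologicalSpace Q] [IsTopologicalGroup Q] (G : PSCDatum Q),
      Ω.IsOfPSCType G → CompactSpace Q ∧ T2Space Q ∧ TotallyDisconnectedSpace Q ∧
        ∃ (S : Set ℕ) (g r g₀ s : ℕ) (ι : PuncturedSurfaceGroup g r →* Q) (e : G.graph.C ≃ Fin r)
          (v₀ v₁ : G.graph.V) (n₀ : G.graph.N) (ε : PuncturedSurfaceGroup g r),
          S.Nonempty ∧ (∀ p ∈ S, p.Prime) ∧ IsProSigmaCompletion S ι ∧ g₀ ≤ g ∧ s = 0 ∧ 1 ≤ r ∧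
          (1 ≤ g₀ ∨ 2 ≤ r) ∧ 1 ≤ g - g₀ ∧
          (∀ c, G.cuspGp c =
            ((PuncturedSurfaceGroup.cuspInertia (g := g) (e c)).map ι).topologicalClosure) ∧
          (∀ w, w = v₀ ∨ w = v₁) ∧ (∀ n, n = n₀) ∧
          ε = ((List.finRange r).map fun j : Fin r =>
            if s ≤ (j : ℕ) then PuncturedSurfaceGroup.c (g := g) j else 1).prod *
          ((List.finRange g).map fun i : Fin g => if (i : ℕ) < g₀ then
            PuncturedSurfaceGroup.a (r := r) i * PuncturedSurfaceGroup.b i *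
              (PuncturedSurfaceGroup.a i)⁻¹ * (PuncturedSurfaceGroup.b i)⁻¹ else 1).prod ∧
          G.vertGp v₀ = ((Subgroup.closure {x : PuncturedSurfaceGroup g r |
            (∃ i : Fin g, (i : ℕ) < g₀ ∧ (x = PuncturedSurfaceGroup.a i ∨ x = PuncturedSurfaceGroup.b i)) ∨
            ∃ j : Fin r, s ≤ (j : ℕ) ∧ x = PuncturedSurfaceGroup.c j}).map ι).topologicalClosure ∧
          G.vertGp v₁ = ((Subgroup.closure {x : PuncturedSurfaceGroup g r |
            (∃ i : Fin g, g₀ ≤ (i : ℕ) ∧ (x = PuncturedSurfaceGroup.a i ∨ x = PuncturedSurfaceGroup.b i)) ∨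
            (∃ j : Fin r, (j : ℕ) < s ∧ x = PuncturedSurfaceGroup.c j) ∨ x = ε}).map ι).topologicalClosure ∧
          G.nodeGp n₀ = ((Subgroup.zpowers ε).map ι).topologicalClosure ∧
          G.genus v₀ = g₀ ∧ G.genus v₁ = g - g₀) :
    CommensurableTerminalityHolds Ω := by
  intro Q _ _ _ G hG
  obtain ⟨hc, ht, hd, S, g, r, g₀, s, ι, e, v₀, v₁, n₀, ε, hne, hprime, hι, hg₀, hs, hr, hst₀, hg₁, hC, hV, hN,
    hε, hV₀, hV₁, hE, hgen₀, hgen₁⟩ := hΩ G hG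
  haveI := hc
  haveI := ht
  haveI := hd
  exact G.commensurablyTerminal_of_twoComponentUnmarked hne hprime ι hι hg₀ hs hr hst₀ hg₁ e hC v₀ v₁ hV ε hε
    hV₀ hV₁ n₀ hN hE hgen₀ hgen₁

/-- **F-0459 ∧ F-0438 — [CombGC] Prop. 1.2 (i) AND (ii) as printed — at EVERY origin whose data are of
two-component shape with `C₁` unmarked** (F-0459 there is abc-iut-f-164 gen 2's
`openInterDeterminesComponentHolds_of_twoComponentUnmarked`). [cite: MochizukiCombGC2007, Prop 1.2 pp.8-9] -/
theorem twoComponentUnmarkedOrigin_prop12_holds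
    (hΩ : ∀ ⦃Q : Type⦄ [Group Q] [TopologicalSpace Q] [IsTopologicalGroup Q] (G : PSCDatum Q),
      Ω.IsOfPSCType G → CompactSpace Q ∧ T2Space Q ∧ TotallyDisconnectedSpace Q ∧
        ∃ (S : Set ℕ) (g r g₀ s : ℕ) (ι : PuncturedSurfaceGroup g r →* Q) (e : G.graph.C ≃ Fin r)
          (v₀ v₁ : G.graph.V) (n₀ : G.graph.N) (ε : PuncturedSurfaceGroup g r),
          S.Nonempty ∧ (∀ p ∈ S, p.Prime) ∧ IsProSigmaCompletion S ι ∧ g₀ ≤ g ∧ s = 0 ∧ 1 ≤ r ∧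
          (1 ≤ g₀ ∨ 2 ≤ r) ∧ 1 ≤ g - g₀ ∧
          (∀ c, G.cuspGp c =
            ((PuncturedSurfaceGroup.cuspInertia (g := g) (e c)).map ι).topologicalClosure) ∧
          (∀ w, w = v₀ ∨ w = v₁) ∧ (∀ n, n = n₀) ∧
          ε = ((List.finRange r).map fun j : Fin r =>
            if s ≤ (j : ℕ) then PuncturedSurfaceGroup.c (g := g) j else 1).prod *
          ((List.finRange g).map fun i : Fin g => if (i : ℕ) < g₀ then
            PuncturedSurfaceGroup.a (r := r) i * PuncturedSurfaceGroup.b i *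
              (PuncturedSurfaceGroup.a i)⁻¹ * (PuncturedSurfaceGroup.b i)⁻¹ else 1).prod ∧
          G.vertGp v₀ = ((Subgroup.closure {x : PuncturedSurfaceGroup g r |
            (∃ i : Fin g, (i : ℕ) < g₀ ∧ (x = PuncturedSurfaceGroup.a i ∨ x = PuncturedSurfaceGroup.b i)) ∨
            ∃ j : Fin r, s ≤ (j : ℕ) ∧ x = PuncturedSurfaceGroup.c j}).map ι).topologicalClosure ∧
          G.vertGp v₁ = ((Subgroup.closure {x : PuncturedSurfaceGroup g r |
            (∃ i : Fin g, g₀ ≤ (i : ℕ) ∧ (x = PuncturedSurfaceGroup.a i ∨ x = PuncturedSurfaceGroup.b i)) ∨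
            (∃ j : Fin r, (j : ℕ) < s ∧ x = PuncturedSurfaceGroup.c j) ∨ x = ε}).map ι).topologicalClosure ∧
          G.nodeGp n₀ = ((Subgroup.zpowers ε).map ι).topologicalClosure ∧
          G.genus v₀ = g₀ ∧ G.genus v₁ = g - g₀) :
    OpenInterDeterminesComponentHolds Ω ∧ CommensurableTerminalityHolds Ω :=
  ⟨openInterDeterminesComponentHolds_of_twoComponentUnmarked Ω hΩ,
    twoComponentUnmarkedOrigin_commensurableTerminalityHolds Ω hΩ⟩

/-- **F-2830 `SeparatingCoveringsHolds Ω` at EVERY origin whose data are of two-component shape with `C₁`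
unmarked and at least two marked points** (gen 2's origin hypothesis with `2 ≤ r`).
[cite: MochizukiCombGC2007, Prop 1.2 proof p.9] -/
theorem twoComponentUnmarkedOrigin_separatingCoveringsHolds
    (hΩ : ∀ ⦃Q : Type⦄ [Group Q] [TopologicalSpace Q] [IsTopologicalGroup Q] (G : PSCDatum Q),
      Ω.IsOfPSCType G → CompactSpace Q ∧ T2Space Q ∧ TotallyDisconnectedSpace Q ∧
        ∃ (S : Set ℕ) (g r g₀ s : ℕ) (ι : PuncturedSurfaceGroup g r →* Q) (e : G.graph.C ≃ Fin r)
          (v₀ v₁ : G.graph.V) (n₀ : G.graph.N) (ε : PuncturedSurfaceGroup g r),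
          S.Nonempty ∧ (∀ p ∈ S, p.Prime) ∧ IsProSigmaCompletion S ι ∧ g₀ ≤ g ∧ s = 0 ∧ 2 ≤ r ∧
          (1 ≤ g₀ ∨ 2 ≤ r) ∧ 1 ≤ g - g₀ ∧
          (∀ c, G.cuspGp c =
            ((PuncturedSurfaceGroup.cuspInertia (g := g) (e c)).map ι).topologicalClosure) ∧
          (∀ w, w = v₀ ∨ w = v₁) ∧ (∀ n, n = n₀) ∧
          ε = ((List.finRange r).map fun j : Fin r =>
            if s ≤ (j : ℕ) then PuncturedSurfaceGroup.c (g := g) j else 1).prod *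
          ((List.finRange g).map fun i : Fin g => if (i : ℕ) < g₀ then
            PuncturedSurfaceGroup.a (r := r) i * PuncturedSurfaceGroup.b i *
              (PuncturedSurfaceGroup.a i)⁻¹ * (PuncturedSurfaceGroup.b i)⁻¹ else 1).prod ∧
          G.vertGp v₀ = ((Subgroup.closure {x : PuncturedSurfaceGroup g r |
            (∃ i : Fin g, (i : ℕ) < g₀ ∧ (x = PuncturedSurfaceGroup.a i ∨ x = PuncturedSurfaceGroup.b i)) ∨
            ∃ j : Fin r, s ≤ (j : ℕ) ∧ x = PuncturedSurfaceGroup.c j}).map ι).topologicalClosure ∧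
          G.vertGp v₁ = ((Subgroup.closure {x : PuncturedSurfaceGroup g r |
            (∃ i : Fin g, g₀ ≤ (i : ℕ) ∧ (x = PuncturedSurfaceGroup.a i ∨ x = PuncturedSurfaceGroup.b i)) ∨
            (∃ j : Fin r, (j : ℕ) < s ∧ x = PuncturedSurfaceGroup.c j) ∨ x = ε}).map ι).topologicalClosure ∧
          G.nodeGp n₀ = ((Subgroup.zpowers ε).map ι).topologicalClosure ∧
          G.genus v₀ = g₀ ∧ G.genus v₁ = g - g₀) :
    SeparatingCoveringsHolds Ω := by
  intro Q _ _ _ G hG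
  obtain ⟨hc, -, hd, S, g, r, g₀, s, ι, e, v₀, v₁, n₀, ε, hne, hprime, hι, hg₀, hs, hr, -, hg₁, hC, hV, hN,
    hε, hV₀, hV₁, hE, hgen₀, hgen₁⟩ := hΩ G hG
  haveI := hc
  haveI := hd
  exact G.separatingCoverings_of_twoComponentUnmarked hne hprime ι hι hg₀ hs hr hg₁ e hC v₀ v₁ hV ε hε hV₀ hV₁
    n₀ hN hE hgen₀ hgen₁

/-- **F-2829 ∧ Prop. 1.2 (i) ∧ Prop. 1.2 (ii), datum-wise, at every origin whose data are of two-component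
shape with `C₁` unmarked and `r ≥ 2`** — abc-iut-f-164 gen 5's origin row (p501083, same basename; restored
here after the two seats' files crossed at the gate), over its hypothesis form (gen 2's origin hypothesis with
`2 ≤ r`, the stability disjunct dropped). [cite: MochizukiCombGC2007, Prop 1.2 pp.8-9] -/
theorem twoComponentUnmarkedOrigin_prop12_rows
    (hΩ : ∀ ⦃Q : Type⦄ [Group Q] [TopologicalSpace Q] [IsTopologicalGroup Q] (G : PSCDatum Q),
      Ω.IsOfPSCType G → CompactSpace Q ∧ T2Space Q ∧ TotallyDisconnectedSpace Q ∧
        ∃ (S : Set ℕ) (g r g₀ s : ℕ) (ι : PuncturedSurfaceGroup g r →* Q) (e : G.graph.C ≃ Fin r)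
          (v₀ v₁ : G.graph.V) (n₀ : G.graph.N) (ε : PuncturedSurfaceGroup g r),
          S.Nonempty ∧ (∀ p ∈ S, p.Prime) ∧ IsProSigmaCompletion S ι ∧ g₀ ≤ g ∧ s = 0 ∧ 2 ≤ r ∧
          1 ≤ g - g₀ ∧
          (∀ c, G.cuspGp c =
            ((PuncturedSurfaceGroup.cuspInertia (g := g) (e c)).map ι).topologicalClosure) ∧
          (∀ w, w = v₀ ∨ w = v₁) ∧ (∀ n, n = n₀) ∧
          ε = ((List.finRange r).map fun j : Fin r =>
            if s ≤ (j : ℕ) then PuncturedSurfaceGroup.c (g := g) j else 1).prod *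
          ((List.finRange g).map fun i : Fin g => if (i : ℕ) < g₀ then
            PuncturedSurfaceGroup.a (r := r) i * PuncturedSurfaceGroup.b i *
              (PuncturedSurfaceGroup.a i)⁻¹ * (PuncturedSurfaceGroup.b i)⁻¹ else 1).prod ∧
          G.vertGp v₀ = ((Subgroup.closure {x : PuncturedSurfaceGroup g r |
            (∃ i : Fin g, (i : ℕ) < g₀ ∧ (x = PuncturedSurfaceGroup.a i ∨ x = PuncturedSurfaceGroup.b i)) ∨
            ∃ j : Fin r, s ≤ (j : ℕ) ∧ x = PuncturedSurfaceGroup.c j}).map ι).topologicalClosure ∧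
          G.vertGp v₁ = ((Subgroup.closure {x : PuncturedSurfaceGroup g r |
            (∃ i : Fin g, g₀ ≤ (i : ℕ) ∧ (x = PuncturedSurfaceGroup.a i ∨ x = PuncturedSurfaceGroup.b i)) ∨
            (∃ j : Fin r, (j : ℕ) < s ∧ x = PuncturedSurfaceGroup.c j) ∨ x = ε}).map ι).topologicalClosure ∧
          G.nodeGp n₀ = ((Subgroup.zpowers ε).map ι).topologicalClosure ∧
          G.genus v₀ = g₀ ∧ G.genus v₁ = g - g₀) :
    ∀ ⦃Q : Type⦄ [Group Q] [TopologicalSpace Q] [IsTopologicalGroup Q] (G : PSCDatum Q),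
      Ω.IsOfPSCType G → G.SeparatingCoverings ∧
        (G.VerticialOpenInterDeterminesVertex ∧ G.EdgeLikeOpenInterDeterminesEdge ∧
          G.UnrVerticialOpenInterDeterminesVertex) ∧
        (G.VerticialEdgeLikeCommensurablyTerminal ∧ G.UnrVerticialCommensurablyTerminal) := by
  intro Q _ _ _ G hG
  obtain ⟨hc, ht, hd, S, g, r, g₀, s, ι, e, v₀, v₁, n₀, ε, hne, hprime, hι, hg₀, hs, hr, hg₁, hC, hV, hN, hε,
    hV₀, hV₁, hE, hgen₀, hgen₁⟩ := hΩ G hG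
  haveI := hc
  haveI := ht
  haveI := hd
  exact ⟨G.separatingCoverings_of_twoComponentUnmarked hne hprime ι hι hg₀ hs hr hg₁ e hC v₀ v₁ hV ε hε hV₀
      hV₁ n₀ hN hE hgen₀ hgen₁,
    G.prop12_of_twoComponentUnmarked hne hprime ι hι hg₀ hs (by omega) (Or.inr hr) hg₁ e hC v₀ v₁ hV ε hε
      hV₀ hV₁ n₀ hN hE hgen₀ hgen₁⟩

end Origin

end PSCDatum

end Literature.AnabelianGeometry.SemiGraphs

end
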